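import Literature.NumberTheory.Sieve.LargestPrimeFactorCubicABCount
import Literature.NumberTheory.Sieve.LargestPrimeFactorCubicRootCountMult
import Literature.NumberTheory.Sieve.LargestPrimeFactorCubicS0Expand
import Literature.NumberTheory.Sieve.LargestPrimeFactorCubicSieveMain
import HarnessLib

/-!
# Heath-Brown 2001 (PLMS), §6 (6.1)–(6.2): the main term of a pair `(a,b)` factorises as
# `m f(q) σ₁(q) σ₂(q)`, with `σ₂(q) = ∑_{d∣Q} λ_d g_q(d)/d` the Rosser main sum of (2.8)

Topic `Literature/NumberTheory/Sieve`; a PROVED layer (definitions with bodies, no named facts) under the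
named fact `Irving2015_largestPrimeFactor_cubic` (`LargestPrimeFactorCubic.lean`), continuing `…ABCount`
(`|W(a,b) − m f(q) ∑_d ∑_p λ_d 𝟙 ρ(pd)/(pd)| ≤ 3^{ω(q)} ∑∑|λ_d| 𝟙ρ(pd)`).  Source: D. R. Heath-Brown,
*The largest prime factor of `X³ + 2`*, Proc. London Math. Soc. (3) 82 (2001) 554–596, §6 pp. 21–23:
(6.1) `S₀ = ∑_{a,b: q∈𝒬} f(q) I(a,b) σ₁(q) σ₂(q) + o(1)`, (6.2) `σ₁(q) = ∑_{K∈𝒦, (K,q)=1} ρ(K)/N(K)`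
`= ∑_{X^{3δ}<p≤X^{4δ}, p∤q} g(p)/p`, `σ₂(q) = ∑_{A∣R,(A,q)=1} λ_{N(A)} ρ(A)/N(A) = ∑_{d∣Q} λ_d g_q(d)/d`,
"`g_q(d)` is the multiplicative function defined by taking `g_q(p) = 0` for `p ∣ 2q`, and `g_q(p) =
#{P : N(P) = p}` otherwise" — so that (2.8) applies to `σ₂(q)`.

PROVED here:

* `sigma1 X q = ∑_{p∈𝒦, p∤q} g(p)/p`, `sigma2 X q = ∑_{d∣Q} λ_d g_q(d)/d` with
  `gq q d = 𝟙[d odd, (d,q)=1] ρ(d)` (`ρ(d) = #rootsCube d = ∏_{ℓ∣d} g(ℓ)` on square-free `d`);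
* **`sum_lam_Aind_rho_eq`** — `∑_{d∣Q} λ_d ∑_{p∈𝒦} 𝟙(d,p) ρ(pd)/(pd) = σ₁(q) σ₂(q)`
  (`ρ(pd) = g(p)ρ(d)`, `…RootCountMult`);
* **`sigma2_eq_mainSum`** — `σ₂(q) = BetaSieve.mainSum 0 (gDens (2q)) 2 X^{3δ} Q`, the lower Rosser
  main sum of the density `gDens (2q)` of `…SieveMain` (so `sieve_mainSum_ge` bounds it from below by
  `(C₀ − ε) ∏_{p<X^δ}(1 − g_{2q}(p)/p)`);
* `sum_abs_lam_Aind_rho_le` — the error of `…ABCount`: `∑_{d∣Q}|λ_d|∑_p 𝟙ρ(pd) ≤ 3 #𝒦 ∑_{d∣Q}|λ_d| ρ(d)`,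
  and `sum_abs_lam_rho_le` — `∑_{d∣Q} |λ_d| ρ(d) ≤ ∑_{d<X^{3δ}} ρ(d)` (the level of Rosser's weights, `X ≥ 2`).

## References

* D. R. Heath-Brown, *The largest prime factor of `X³ + 2`*, Proc. London Math. Soc. (3) 82 (2001)
  554–596, §6 (6.1)–(6.2) pp. 21–22, (2.8) p. 8. [`HeathBrown2001LargestPrimeFactorCubic`]

## Mathlib / tree search

Tree: `Aind`, `rho3`, `Wab` (`…ABCount`), `rootsCube`, `card_rootsCube_mul`,
`card_rootsCube_eq_cubeRootTwoCount`, `card_rootsCube_squarefree_eq_prod_g`, `card_rootsCube_prime_le`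
(`…RootCountMult`), `coprime_of_dvd_sievePrimes` (`…S0Expand`), `gDens`, `gDensAt` (`…SieveMain`),
`BetaSieve.mainSum`, `lt_level_of_pred_of_one_le`, `ind_of_not_pred` (`RosserSieveMainTerm`,
`SieveFrameworkFundamentalLemma`), `lam`, `sievePrimes`, `sieveLevel`, `kPrimes`, `mem_kPrimes`, `hbδ` (`…Setup`).
-/

noncomputable section

open Finset Real ArithmeticFunction
open scoped ArithmeticFunction.Moebius

namespace Literature.NumberTheory.Sieve.HeathBrown2001

open LargestPrimeFactorCubic BetaSieve CubicPrimes

/-! ### `σ₁`, `σ₂`, `g_q` -/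

/-- `σ₁(q) = ∑_{p ∈ 𝒦, p ∤ q} g(p)/p` ((6.2) with (6.3)). [cite: HeathBrown2001LargestPrimeFactorCubic, (6.2)] -/
def sigma1 (X q : ℕ) : ℝ := ∑ p ∈ (kPrimes X).filter (fun p => ¬ p ∣ q), (cubeRootTwoCount p : ℝ) / p

/-- `g_q(d) = 𝟙[d odd, (d, q) = 1] ρ(d)` (`= ∏_{ℓ∣d} g(ℓ)` for square-free `d` coprime to `2q`, else `0`).
[cite: HeathBrown2001LargestPrimeFactorCubic, §6 p. 22 (g_q)] -/
def gq (q d : ℕ) : ℝ := if Odd d ∧ d.Coprime q then (#(rootsCube d) : ℝ) else 0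

/-- `σ₂(q) = ∑_{d∣Q} λ_d g_q(d)/d`. [cite: HeathBrown2001LargestPrimeFactorCubic, §6 p. 22 (σ₂)] -/
def sigma2 (X q : ℕ) : ℝ := ∑ d ∈ (sievePrimes X).divisors, lam X d * gq q d / d

/-- `rho3 e = #rootsCube e`. [folklore] -/
theorem rho3_eq (e : ℕ) : rho3 e = #(rootsCube e) := rfl

/-! ### The factorisation `σ₁ σ₂` -/

/-- For `d ∣ Q` and `p ∈ 𝒦`: `𝟙(d,p) ρ(pd)/(pd) = ([p ∤ q] g(p)/p) · (g_q(d)/d)`.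
[cite: HeathBrown2001LargestPrimeFactorCubic, §6 (6.1)–(6.2)] -/
theorem Aind_mul_rho_div_eq {X q d p : ℕ} (hd : d ∣ sievePrimes X) (hp : p ∈ kPrimes X) :
    Aind q d p * rho3 (p * d) / ((p : ℝ) * d) =
      (if ¬ p ∣ q then (cubeRootTwoCount p : ℝ) / p else 0) * (gq q d / d) := by
  have hpP := (mem_kPrimes hp).1
  have hcop : Nat.Coprime p d := (coprime_of_dvd_sievePrimes hd hp).symm
  unfold Aind gq
  by_cases hA : Odd d ∧ d.Coprime q ∧ ¬ p ∣ q
  · rw [if_pos hA, if_pos hA.2.2, if_pos ⟨hA.1, hA.2.1⟩, rho3_eq, card_rootsCube_mul hcop,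
      card_rootsCube_eq_cubeRootTwoCount]
    push_cast
    have hp0 : (p : ℝ) ≠ 0 := by exact_mod_cast hpP.ne_zero
    rcases Nat.eq_zero_or_pos d with rfl | hd0
    · simp
    · have hd0' : (d : ℝ) ≠ 0 := by exact_mod_cast hd0.ne'
      field_simp
  · rw [if_neg hA, zero_mul, zero_div]
    by_cases hpq : ¬ p ∣ q
    · have : ¬ (Odd d ∧ d.Coprime q) := fun h => hA ⟨h.1, h.2, hpq⟩
      rw [if_neg this]; simp
    · rw [if_neg hpq]; simp

/-- **`∑_{d∣Q} λ_d ∑_{p∈𝒦} 𝟙(d,p) ρ(pd)/(pd) = σ₁(q) σ₂(q)`**. [cite: HeathBrown2001LargestPrimeFactorCubic, §6 (6.1)–(6.2)] -/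
theorem sum_lam_Aind_rho_eq (X q : ℕ) :
    ∑ d ∈ (sievePrimes X).divisors, lam X d * ∑ p ∈ kPrimes X, Aind q d p * rho3 (p * d) / ((p : ℝ) * d) =
      sigma1 X q * sigma2 X q := by
  rw [sigma2, mul_sum]
  refine sum_congr rfl fun d hd => ?_
  have hdQ := Nat.dvd_of_mem_divisors hd
  rw [sum_congr rfl fun p hp => Aind_mul_rho_div_eq (q := q) hdQ hp, ← sum_mul, sigma1, sum_filter]
  ring

/-! ### `σ₂` is the Rosser main sum of `gDens (2q)` -/

/-- On square-free `d`: `gDens (2q) d = g_q(d)/d`. [cite: HeathBrown2001LargestPrimeFactorCubic, §6 p. 22] -/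
theorem gDens_two_mul_eq (q : ℕ) {d : ℕ} (hd : Squarefree d) : gDens (2 * q) d = gq q d / d := by
  have hd0 := hd.ne_zero
  rw [gDens, ArithmeticFunction.prodPrimeFactors_apply hd0, gq]
  by_cases h : Odd d ∧ d.Coprime q
  · -- every prime factor of `d` is coprime to `2q`
    rw [if_pos h, card_rootsCube_squarefree_eq_prod_g hd]
    have hval : ∀ p ∈ d.primeFactors, gDensAt (2 * q) p = (cubeRootTwoCount p : ℝ) / p := by
      intro p hp
      have hpP := Nat.prime_of_mem_primeFactors hp
      have hpd := Nat.dvd_of_mem_primeFactors hp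
      rw [gDensAt, if_neg]
      intro h2q
      rcases (Nat.Prime.dvd_mul hpP).mp h2q with h2 | hq'
      · have : p = 2 := (Nat.prime_dvd_prime_iff_eq hpP Nat.prime_two).mp h2
        subst this
        exact (Nat.not_even_iff_odd.mpr h.1) (even_iff_two_dvd.mpr hpd)
      · exact (Nat.Prime.coprime_iff_not_dvd hpP).mp (h.2.coprime_dvd_left hpd) hq'
    rw [prod_congr rfl hval, prod_div_distrib, ← Nat.cast_prod, ← Nat.cast_prod,
      Nat.prod_primeFactors_of_squarefree hd]
  · rw [if_neg h, zero_div]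
    -- some prime factor of `d` divides `2q`
    have : ∃ p ∈ d.primeFactors, p ∣ 2 * q := by
      by_cases hodd : Odd d
      · have hcop : ¬ d.Coprime q := fun hc => h ⟨hodd, hc⟩
        obtain ⟨p, hp, hpd, hpq⟩ := Nat.Prime.not_coprime_iff_dvd.mp hcop
        exact ⟨p, Nat.mem_primeFactors.mpr ⟨hp, hpd, hd0⟩, hpq.mul_left 2⟩
      · rw [Nat.not_odd_iff_even, even_iff_two_dvd] at hodd
        exact ⟨2, Nat.mem_primeFactors.mpr ⟨Nat.prime_two, hodd, hd0⟩, dvd_mul_right 2 q⟩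
    obtain ⟨p, hp, hp2q⟩ := this
    exact prod_eq_zero hp (by rw [gDensAt, if_pos hp2q])

/-- **`σ₂(q) = S⁻(gDens (2q))`**, the lower Rosser main sum of level `X^{3δ}` over `Q = P(X^δ)`.
[cite: HeathBrown2001LargestPrimeFactorCubic, (2.8) and §6 p. 22] -/
theorem sigma2_eq_mainSum (X q : ℕ) :
    sigma2 X q = mainSum 0 (gDens (2 * q)) 2 (sieveLevel X) (sievePrimes X) := by
  rw [sigma2, mainSum]
  refine sum_congr rfl fun d hd => ?_
  have hsq : Squarefree d := (squarefree_primesProdBelow _).squarefree_of_dvd (Nat.dvd_of_mem_divisors hd)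
  rw [gDens_two_mul_eq q hsq, lam]
  ring

/-! ### The error terms -/

/-- `∑_{d∣Q} |λ_d| ∑_{p∈𝒦} 𝟙(d,p) ρ(pd) ≤ 3 #𝒦 ∑_{d∣Q} |λ_d| ρ(d)`. [folklore] -/
theorem sum_abs_lam_Aind_rho_le (X q : ℕ) :
    ∑ d ∈ (sievePrimes X).divisors, |lam X d| * ∑ p ∈ kPrimes X, Aind q d p * rho3 (p * d) ≤
      3 * #(kPrimes X) * ∑ d ∈ (sievePrimes X).divisors, |lam X d| * #(rootsCube d) := by
  rw [mul_sum]
  refine sum_le_sum fun d hd => ?_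
  have hdQ := Nat.dvd_of_mem_divisors hd
  have hinner : ∑ p ∈ kPrimes X, Aind q d p * rho3 (p * d) ≤ ∑ _p ∈ kPrimes X, (3 : ℝ) * #(rootsCube d) := by
    refine sum_le_sum fun p hp => ?_
    have hpP := (mem_kPrimes hp).1
    have hcop : Nat.Coprime p d := (coprime_of_dvd_sievePrimes hdQ hp).symm
    have hA : Aind q d p ≤ 1 := by unfold Aind; split_ifs <;> norm_num
    have hA0 : 0 ≤ Aind q d p := by unfold Aind; split_ifs <;> norm_num
    rw [rho3_eq, card_rootsCube_mul hcop]
    push_cast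
    have h3 : (#(rootsCube p) : ℝ) ≤ 3 := by exact_mod_cast card_rootsCube_prime_le hpP
    calc Aind q d p * ((#(rootsCube p) : ℝ) * #(rootsCube d)) ≤ 1 * (3 * #(rootsCube d)) := by
          apply mul_le_mul hA _ (by positivity) zero_le_one
          exact mul_le_mul_of_nonneg_right h3 (by positivity)
      _ = 3 * #(rootsCube d) := one_mul _
  calc |lam X d| * ∑ p ∈ kPrimes X, Aind q d p * rho3 (p * d)
      ≤ |lam X d| * ∑ _p ∈ kPrimes X, (3 : ℝ) * #(rootsCube d) := mul_le_mul_of_nonneg_left hinner (abs_nonneg _)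
    _ = 3 * #(kPrimes X) * (|lam X d| * #(rootsCube d)) := by rw [sum_const, nsmul_eq_mul]; ring

/-- **The level of Rosser's weights**: `λ_d = 0` unless `d < X^{3δ}` (`X ≥ 2`), hence
`∑_{d∣Q} |λ_d| ρ(d) ≤ ∑_{d < ⌈X^{3δ}⌉} ρ(d)`. [cite: HeathBrown2001LargestPrimeFactorCubic, (2.7) and §6 p. 21 ("N(A) ≤ X^{3δ}")] -/
theorem sum_abs_lam_rho_le {X : ℕ} (hX : 2 ≤ X) :
    ∑ d ∈ (sievePrimes X).divisors, |lam X d| * #(rootsCube d) ≤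
      ∑ d ∈ Finset.range ⌈(X : ℝ) ^ (3 * hbδ)⌉₊, (#(rootsCube d) : ℝ) := by
  classical
  have hδ := hbδ_pos
  have hX1 : (1 : ℝ) < X := by exact_mod_cast hX
  have hD1 : 1 < sieveLevel X := by
    rw [sieveLevel]; exact Real.one_lt_rpow hX1 (by linarith)
  have hzD : (X : ℝ) ^ hbδ ≤ sieveLevel X := by
    rw [sieveLevel]; exact Real.rpow_le_rpow_of_exponent_le hX1.le (by linarith)
  -- drop the `d` with `λ_d = 0`, bound `|λ_d| ≤ 1`, and use the level
  have hsupp : ∀ d ∈ (sievePrimes X).divisors, lam X d ≠ 0 → d ∈ Finset.range ⌈(X : ℝ) ^ (3 * hbδ)⌉₊ := by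
    intro d hd hne
    have hdQ := Nat.dvd_of_mem_divisors hd
    have hsq : Squarefree d := (squarefree_primesProdBelow _).squarefree_of_dvd hdQ
    have hpred : pred 0 2 (sieveLevel X) d := by
      by_contra hnp
      exact hne (by rw [lam, ind_of_not_pred hnp, mul_zero])
    have hpz : ∀ p ∈ d.primeFactors, (p : ℝ) < (X : ℝ) ^ hbδ := by
      intro p hp
      have hpP := Nat.prime_of_mem_primeFactors hp
      have : p ∣ sievePrimes X := (Nat.dvd_of_mem_primeFactors hp).trans hdQ
      rwa [sievePrimes, dvd_primesProdBelow_iff hpP] at this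
    have hlt := lt_level_of_pred_of_one_le (par := 0) (by norm_num : (1:ℝ) ≤ 2) hD1 hzD hsq hpz hpred
    rw [Finset.mem_range, Nat.lt_ceil]
    rw [sieveLevel] at hlt
    exact hlt
  calc ∑ d ∈ (sievePrimes X).divisors, |lam X d| * #(rootsCube d)
      = ∑ d ∈ (sievePrimes X).divisors.filter (fun d => lam X d ≠ 0), |lam X d| * #(rootsCube d) := by
        rw [sum_filter_of_ne]
        intro d _ hne h0
        rw [h0, abs_zero, zero_mul] at hne
        exact hne rfl
    _ ≤ ∑ d ∈ (sievePrimes X).divisors.filter (fun d => lam X d ≠ 0), (#(rootsCube d) : ℝ) := by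
        refine sum_le_sum fun d _ => ?_
        have := abs_lam_le X d
        calc |lam X d| * #(rootsCube d) ≤ 1 * #(rootsCube d) := mul_le_mul_of_nonneg_right this (by positivity)
          _ = _ := one_mul _
    _ ≤ ∑ d ∈ Finset.range ⌈(X : ℝ) ^ (3 * hbδ)⌉₊, (#(rootsCube d) : ℝ) := by
        refine sum_le_sum_of_subset_of_nonneg (fun d hd => ?_) fun _ _ _ => by positivity
        rw [mem_filter] at hd
        exact hsupp d hd.1 hd.2

end Literature.NumberTheory.Sieve.HeathBrown2001
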